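import Summits.NavierStokesRegularity.NavierStokesRegularity.Theorems.AxisTwistDoorAveragedConeLiouvilleNUStandingOfWeakFrames
import Summits.NavierStokesRegularity.NavierStokesRegularity.Theorems.AxisTwistDoorAveragedConeLiouvilleNUEnergyClassFrameTools
import HarnessLib

/-!
# N4 / T1 piece W, brick (c2): the ENERGY CLASS OF THE FRAME PAIR from the data-coordinate energy
# inequality (brick (b) at the cut-off pair `(ψV, b)`), and the `∃ Φ U` frame theorem consumed by the W assembly

Route `AxisTwistDoor`, crux `AveragedConeLiouville` (stmt-NavierStokesRegularity-26889, CLOSED; T1 re-proves the typed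
INPUT `NazarovUraltseva2011_positivity_propagation (EuclideanSpace ℝ (Fin 3))` at Literature pace), kit
`pub/ns-inputs/kits/N4-T1-skeleton.lean` 118454bf17607d1e, stub W = `Sig.nu_standing_of_weak` (owner ns-in-ser-c g2:
(a) p640063, (b1) p640527, (b) `nu_energyIneq_of_weak` = `kits/N4-T1-W2b-text.lean`; (W0) time cut-off ns-in-ser-b g2;
(c) frames p640912 and (c2) = this file, ns-in-ser-a g3; pub/ns-inputs STATUS 2026-08-28T14:22–14:25Z).

WHAT THIS FILE DOES. `nuSlabIneq Φ U H Θ η u v` names the inequality of `NUEnergyClass` (`…NUDefs`) on one slab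
`[u,v]` (so `NUEnergyClass Φ U k R` is `∀ H … Θ … η … t₁ t₂ …, nuSlabIneq Φ U H Θ η t₁ t₂` by `Iff.rfl`, and brick
(b)'s conclusion for a pair `(Ṽ, b)` on `]0,T[` is `nuSlabIneq Ṽ b H Θ η t₁ t₂` for `0 < t₁ ≤ t₂ < T`). For the frame
pair `(frameΦ χ ψ V τ, frameU ψ₁ b τ)` of brick (c) with `ψ = 0` on `]-∞,t⋆/2]`, `ψ₁ = 𝟙_{[t⋆/2,∞[}` (any measurable
`ψ₁` with `ψ₁ = 0` below and `= 1` from `t⋆/2` on), `χ = 1` on `B̄(0,R')`, `2R ≤ R' < 1`: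
* `nuSlabIneq_frame_of_data` — TRANSPORT: on a frame slab `[a,v]` with `t⋆/2 ≤ a+τ`, `v < 0`, the data-coordinate
  inequality for `(ψV, b)` on `[a+τ, v+τ]` with the weight `η(·-τ)` IS the frame inequality (measure-preserving
  shift `(t,x) ↦ (t+τ,x)`; `χ` is invisible on `tsupport Θ ⊆ B(0,2R) ⊆ B(0,R')`, for values AND gradients; the `Θ`
  factors kill everything off `tsupport Θ`; `ψ₁ = 1` on the data slab);
* `nuSlabIneq_extend` — TRIVIAL EXTENSION DOWNWARDS: if `Φ(t,·) = 0` for `t ≤ a` and `U(t,·) = 0` for `t < a`,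
  the inequality on `[a,v]` implies the one on `[t₁,v]`, `t₁ ≤ a` (real bookkeeping: `M(t₁) = M(a) = H(0)∫Θ²`, the
  dissipation and the drift term do not see `[t₁,a[`, `η(a) - η(t₁) ≤ ∫|η'|`, the `|∇Θ|²` term is monotone — the
  slab below the data carries NO `ofReal` truncation issue because its dissipation vanishes);
* `nuEnergyClass_frame` — the energy class `NUEnergyClass (frameΦ χ ψ V τ) (frameU ψ₁ b τ) k R` from the
  data-coordinate inequality for the pair `(fun s x => ψ s * V s x, b)` (hypothesis `hineq`, = ser-c's
  `nu_energyIneq_of_weak hW1` applied to ser-b's (W0) output) — cases `t₂ ≤ c`, `c ≤ t₁`, `t₁ < c < t₂`,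
  `c = t⋆/2 - τ`;
* `exists_nuStandingLip_frame_of_energyIneq` — **the theorem the W assembly consumes**: weak Lipschitz data + an
  admissible frame + a time cut-off `ψ` + `hineq` ⟹ `∃ Φ U, NUStandingLip Φ U k R (nuDriftConst Λ) ∧ Φ = V(·+τ,·)`
  on the frame (χ := a `ContDiffBump`, `ψ₁ := 𝟙_{[t⋆/2,∞[}`, then brick (c) `nuStandingLip_frame`).

WHAT THIS IS NOT: not a statement about Navier–Stokes; T1 is an INPUT (a printed theorem re-proved); the summit stays
open. [cite: NazarovUraltseva2011HarnackDivFree, §3 (arXiv:1011.1888 p. 8)] [cite: LeiRenTian2025, Lemma 2.5]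
-/

noncomputable section

-- the summit and its single sub-problem share the name (CONVENTIONS §1)
set_option linter.dupNamespace false

open MeasureTheory Set Function Filter Topology Metric
open scoped NNReal ENNReal

namespace Summit.NavierStokesRegularity.NavierStokesRegularity.Theorems.AveragedConeLiouville.NUPositivity

/-! ### The frame pair: pointwise facts -/

section Frame

variable {χ : EuclideanSpace ℝ (Fin 3) → ℝ} {ψ ψ₁ : ℝ → ℝ} {V : ℝ → EuclideanSpace ℝ (Fin 3) → ℝ}
  {b : ℝ → EuclideanSpace ℝ (Fin 3) → EuclideanSpace ℝ (Fin 3)} {T τ tstar R R' : ℝ}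

/-- Off `tsupport Θ`, the three `Θ`-factors of the energy integrands vanish. -/
theorem theta_factors_eq_zero {Θ : EuclideanSpace ℝ (Fin 3) → ℝ} {x : EuclideanSpace ℝ (Fin 3)}
    (hx : x ∉ tsupport Θ) : Θ x = 0 ∧ gradient Θ x = 0 ∧ gradient (fun y => Θ y ^ 2) x = 0 := by
  have hev : Θ =ᶠ[𝓝 x] fun _ => 0 := notMem_tsupport_iff_eventuallyEq.mp hx
  have hev2 : (fun y => Θ y ^ 2) =ᶠ[𝓝 x] fun _ => 0 := by
    filter_upwards [hev] with y hy; simp [hy]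
  refine ⟨image_eq_zero_of_notMem_tsupport hx, ?_, ?_⟩
  · unfold gradient; rw [hev.fderiv_eq, fderiv_const_apply]; simp
  · unfold gradient; rw [hev2.fderiv_eq, fderiv_const_apply]; simp

/-- On the open frame ball `B(0,R')` (where `χ = 1` on `B̄(0,R')`), the slice gradient of the frame profile is the
slice gradient of `ψ(t+τ)V(t+τ,·)`. -/
theorem gradient_frameΦ_eq (hχone : ∀ x ∈ closedBall (0 : EuclideanSpace ℝ (Fin 3)) R', χ x = 1) {t : ℝ}
    (ht : t < 0) {x : EuclideanSpace ℝ (Fin 3)} (hx : x ∈ ball (0 : EuclideanSpace ℝ (Fin 3)) R') :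
    gradient (frameΦ χ ψ V τ t) x = gradient (fun y => ψ (t + τ) * V (t + τ) y) x := by
  have hev : frameΦ χ ψ V τ t =ᶠ[𝓝 x] fun y => ψ (t + τ) * V (t + τ) y := by
    filter_upwards [isOpen_ball.mem_nhds hx] with y hy
    exact frameΦ_eq_of_mem_closedBall hχone ht (ball_subset_closedBall hy)
  unfold gradient; rw [hev.fderiv_eq]

/-- **Transport.** On a frame slab `[a,v]` with `t⋆/2 ≤ a + τ` and `v < 0`, the data-coordinate slab inequality
for the pair `(ψV, b)` on `[a+τ, v+τ]` with the weight `η(·-τ)` is the frame slab inequality for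
`(frameΦ χ ψ V τ, frameU ψ₁ b τ)` with the weight `η` (`ψ₁ = 1` on `[t⋆/2,∞[`, `χ = 1` on `B̄(0,R')`,
`tsupport Θ ⊆ B(0,2R)`, `2R ≤ R' ≤ 1`). -/
theorem nuSlabIneq_frame_of_data {H : ℝ → ℝ} {Θ : EuclideanSpace ℝ (Fin 3) → ℝ} {η : ℝ → ℝ} {a v : ℝ}
    (hχone : ∀ x ∈ closedBall (0 : EuclideanSpace ℝ (Fin 3)) R', χ x = 1) (h2R : 2 * R ≤ R') (hR'1 : R' ≤ 1)
    (hφ1 : ∀ s, tstar / 2 ≤ s → ψ₁ s = 1) (ha : tstar / 2 ≤ a + τ) (hav : a ≤ v) (hv : v < 0)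
    (hΘsupp : tsupport Θ ⊆ ball (0 : EuclideanSpace ℝ (Fin 3)) (2 * R))
    (h : nuSlabIneq (fun s x => ψ s * V s x) b H Θ (fun s => η (s - τ)) (a + τ) (v + τ)) :
    nuSlabIneq (frameΦ χ ψ V τ) (frameU ψ₁ b τ) H Θ η a v := by
  unfold nuSlabIneq at h ⊢
  simp only [add_sub_cancel_right, deriv_comp_sub_const] at h
  have hballR' : ball (0 : EuclideanSpace ℝ (Fin 3)) (2 * R) ⊆ ball (0 : EuclideanSpace ℝ (Fin 3)) R' :=
    ball_subset_ball h2R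
  have hball1 : ball (0 : EuclideanSpace ℝ (Fin 3)) (2 * R) ⊆ ball (0 : EuclideanSpace ℝ (Fin 3)) 1 :=
    ball_subset_ball (h2R.trans hR'1)
  -- pointwise identifications on the slab (`t < 0`)
  have hval : ∀ t, t < 0 → ∀ x, H (frameΦ χ ψ V τ t x) * Θ x ^ 2 = H (ψ (t + τ) * V (t + τ) x) * Θ x ^ 2 := by
    intro t ht x
    by_cases hx : x ∈ tsupport Θ
    · rw [frameΦ_eq_of_mem_closedBall hχone ht (ball_subset_closedBall (hballR' (hΘsupp hx)))]
    · rw [(theta_factors_eq_zero hx).1]; simp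
  have hM : ∀ t, t < 0 → ∫ x, H (frameΦ χ ψ V τ t x) * Θ x ^ 2 = ∫ x, H (ψ (t + τ) * V (t + τ) x) * Θ x ^ 2 :=
    fun t ht => integral_congr_ae (Eventually.of_forall (hval t ht))
  have hmem : ∀ z : ℝ × EuclideanSpace ℝ (Fin 3), z ∈ Icc a v ×ˢ (univ : Set (EuclideanSpace ℝ (Fin 3))) →
      z.1 < 0 ∧ tstar / 2 ≤ z.1 + τ := fun z hz => ⟨hz.1.2.trans_lt hv, ha.trans (by linarith [hz.1.1])⟩
  -- the four slab integrals, transported by the shift `(t,x) ↦ (t+τ,x)`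
  have hD : ∫⁻ z in Icc (a + τ) (v + τ) ×ˢ (univ : Set (EuclideanSpace ℝ (Fin 3))), ENNReal.ofReal
        (1 / 2 * η (z.1 - τ) * (deriv (deriv H) (ψ z.1 * V z.1 z.2) *
          ‖gradient (fun y => ψ z.1 * V z.1 y) z.2‖ ^ 2 * Θ z.2 ^ 2)) =
      ∫⁻ z in Icc a v ×ˢ (univ : Set (EuclideanSpace ℝ (Fin 3))), ENNReal.ofReal
        (1 / 2 * η z.1 * (deriv (deriv H) (frameΦ χ ψ V τ z.1 z.2) *
          ‖gradient (frameΦ χ ψ V τ z.1) z.2‖ ^ 2 * Θ z.2 ^ 2)) := by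
    rw [setLIntegral_slab_timeShift]
    refine setLIntegral_congr_fun (measurableSet_Icc.prod MeasurableSet.univ) fun z hz => ?_
    obtain ⟨hz0, -⟩ := hmem z hz
    simp only [add_sub_cancel_right]
    by_cases hx : z.2 ∈ tsupport Θ
    · rw [frameΦ_eq_of_mem_closedBall hχone hz0 (ball_subset_closedBall (hballR' (hΘsupp hx))),
        gradient_frameΦ_eq hχone hz0 (hballR' (hΘsupp hx))]
    · rw [(theta_factors_eq_zero hx).1]; simp
  have hA : ∫ z in Icc (a + τ) (v + τ) ×ˢ (univ : Set (EuclideanSpace ℝ (Fin 3))),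
        η (z.1 - τ) * (H (ψ z.1 * V z.1 z.2) * ‖gradient Θ z.2‖ ^ 2) =
      ∫ z in Icc a v ×ˢ (univ : Set (EuclideanSpace ℝ (Fin 3))),
        η z.1 * (H (frameΦ χ ψ V τ z.1 z.2) * ‖gradient Θ z.2‖ ^ 2) := by
    rw [setIntegral_slab_timeShift]
    refine setIntegral_congr_fun (measurableSet_Icc.prod MeasurableSet.univ) fun z hz => ?_
    obtain ⟨hz0, -⟩ := hmem z hz
    simp only [add_sub_cancel_right]
    by_cases hx : z.2 ∈ tsupport Θ
    · rw [frameΦ_eq_of_mem_closedBall hχone hz0 (ball_subset_closedBall (hballR' (hΘsupp hx)))]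
    · rw [(theta_factors_eq_zero hx).2.1]; simp
  have hB : ∫ z in Icc (a + τ) (v + τ) ×ˢ (univ : Set (EuclideanSpace ℝ (Fin 3))),
        η (z.1 - τ) * (H (ψ z.1 * V z.1 z.2) * inner ℝ (b z.1 z.2) (gradient (fun y => Θ y ^ 2) z.2)) =
      ∫ z in Icc a v ×ˢ (univ : Set (EuclideanSpace ℝ (Fin 3))),
        η z.1 * (H (frameΦ χ ψ V τ z.1 z.2) *
          inner ℝ (frameU ψ₁ b τ z.1 z.2) (gradient (fun y => Θ y ^ 2) z.2)) := by
    rw [setIntegral_slab_timeShift]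
    refine setIntegral_congr_fun (measurableSet_Icc.prod MeasurableSet.univ) fun z hz => ?_
    obtain ⟨hz0, hzs⟩ := hmem z hz
    simp only [add_sub_cancel_right]
    by_cases hx : z.2 ∈ tsupport Θ
    · have hx1 : ‖z.2‖ < 1 := mem_ball_zero_iff.1 (hball1 (hΘsupp hx))
      rw [frameΦ_eq_of_mem_closedBall hχone hz0 (ball_subset_closedBall (hballR' (hΘsupp hx))),
        frameU_eq_of_norm_lt_one hz0 hx1, hφ1 _ hzs, one_smul]
    · rw [(theta_factors_eq_zero hx).2.2]; simp
  have hC : ∫ z in Icc (a + τ) (v + τ) ×ˢ (univ : Set (EuclideanSpace ℝ (Fin 3))),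
        |deriv η (z.1 - τ)| * (H (ψ z.1 * V z.1 z.2) * Θ z.2 ^ 2) =
      ∫ z in Icc a v ×ˢ (univ : Set (EuclideanSpace ℝ (Fin 3))),
        |deriv η z.1| * (H (frameΦ χ ψ V τ z.1 z.2) * Θ z.2 ^ 2) := by
    rw [setIntegral_slab_timeShift]
    refine setIntegral_congr_fun (measurableSet_Icc.prod MeasurableSet.univ) fun z hz => ?_
    obtain ⟨hz0, -⟩ := hmem z hz
    simp only [add_sub_cancel_right]
    rw [hval z.1 hz0 z.2]
  rw [hD, hA, hB, hC, ← hM v hv, ← hM a (hav.trans_lt hv)] at h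
  exact h

/-- Integrability of the `|∇Θ|²`- and `|η'|`-integrands of the frame pair on any slab (they are bounded, jointly
measurable and vanish off `[u,v] × tsupport Θ`; `0 ≤ H(Φ) ≤ H(0)` because `H' ≤ 0` and `Φ ≥ 0`). -/
theorem integrableOn_frame_AC {H : ℝ → ℝ} {Θ : EuclideanSpace ℝ (Fin 3) → ℝ} {η : ℝ → ℝ} {u v : ℝ}
    (hH2 : ContDiff ℝ 2 H) (hH' : ∀ w, deriv H w ≤ 0) (hH0 : ∀ w, 0 ≤ H w)
    (hΘ1 : ContDiff ℝ 1 Θ) (hΘc : HasCompactSupport Θ) (hη1 : ContDiff ℝ 1 η)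
    (hΦm : Measurable (uncurry (frameΦ χ ψ V τ))) (hΦ0 : ∀ t x, 0 ≤ frameΦ χ ψ V τ t x) :
    IntegrableOn (fun z : ℝ × EuclideanSpace ℝ (Fin 3) =>
        η z.1 * (H (frameΦ χ ψ V τ z.1 z.2) * ‖gradient Θ z.2‖ ^ 2))
      (Icc u v ×ˢ (univ : Set (EuclideanSpace ℝ (Fin 3)))) volume ∧
    IntegrableOn (fun z : ℝ × EuclideanSpace ℝ (Fin 3) =>
        |deriv η z.1| * (H (frameΦ χ ψ V τ z.1 z.2) * Θ z.2 ^ 2))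
      (Icc u v ×ˢ (univ : Set (EuclideanSpace ℝ (Fin 3)))) volume := by
  have hHanti : Antitone H := antitone_of_deriv_nonpos (hH2.differentiable (by norm_num)) hH'
  have hg : Measurable fun z : ℝ × EuclideanSpace ℝ (Fin 3) => H (frameΦ χ ψ V τ z.1 z.2) :=
    hH2.continuous.measurable.comp hΦm
  have hgb : ∀ z : ℝ × EuclideanSpace ℝ (Fin 3), |H (frameΦ χ ψ V τ z.1 z.2)| ≤ H 0 := fun z => by
    rw [abs_of_nonneg (hH0 _)]; exact hHanti (hΦ0 z.1 z.2)
  have hgrad : Continuous fun x => gradient Θ x := by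
    have h1 : Continuous (fderiv ℝ Θ) := hΘ1.continuous_fderiv one_ne_zero
    exact (InnerProductSpace.toDual ℝ (EuclideanSpace ℝ (Fin 3))).symm.continuous.comp h1
  have hw1 : Continuous fun x : EuclideanSpace ℝ (Fin 3) => ‖gradient Θ x‖ ^ 2 := hgrad.norm.pow 2
  have hw2 : Continuous fun x : EuclideanSpace ℝ (Fin 3) => Θ x ^ 2 := hΘ1.continuous.pow 2
  refine ⟨integrableOn_slab_of_bdd (K := tsupport Θ) (w := fun x => ‖gradient Θ x‖ ^ 2) hη1.continuous hg hgb
      hw1 hΘc (fun x hx => by simp only [(theta_factors_eq_zero hx).2.1, norm_zero]; norm_num),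
    integrableOn_slab_of_bdd (K := tsupport Θ) (w := fun x => Θ x ^ 2) ((hη1.continuous_deriv le_rfl).abs) hg
      hgb hw2 hΘc (fun x hx => by simp only [(theta_factors_eq_zero hx).1]; norm_num)⟩

/-- **Brick (c2): the energy class of the frame pair.** From the data-coordinate slab inequality for the cut-off
pair `(ψV, b)` on `]0,T[` (hypothesis `hineq` = ser-c's `nu_energyIneq_of_weak hW1` applied to ser-b's (W0)
output; five `H`-clauses, `Θ` supported in `B(0,ρ₀)`, `ρ₀ < 1`, `0 < t₁ ≤ t₂ < T`) and the cut-off data, the frame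
pair `(frameΦ χ ψ V τ, frameU ψ₁ b τ)` satisfies `NUEnergyClass … k R` (for every level cap `k`). -/
theorem nuEnergyClass_frame {k : ℝ}
    (hineq : ∀ (H : ℝ → ℝ), ContDiff ℝ 2 H → (∀ v, deriv H v ≤ 0) → (∀ v, 0 ≤ H v) →
      (∀ v, 0 ≤ deriv (deriv H) v) → (∀ v, deriv H v ^ 2 ≤ 2 * H v * deriv (deriv H) v) →
      ∀ (Θ : EuclideanSpace ℝ (Fin 3) → ℝ), ContDiff ℝ 1 Θ → HasCompactSupport Θ →
      ∀ (ρ₀ : ℝ), ρ₀ < 1 → tsupport Θ ⊆ ball (0 : EuclideanSpace ℝ (Fin 3)) ρ₀ →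
      ∀ (η : ℝ → ℝ), ContDiff ℝ 1 η → (∀ s, 0 ≤ η s) →
      ∀ (t₁ t₂ : ℝ), 0 < t₁ → t₁ ≤ t₂ → t₂ < T →
        nuSlabIneq (fun s x => ψ s * V s x) b H Θ η t₁ t₂)
    (hVL : ∃ L, LipschitzOnWith L (uncurry V) (Ioo 0 T ×ˢ ball (0 : EuclideanSpace ℝ (Fin 3)) 1))
    (hV0 : ∀ t ∈ Ioo 0 T, ∀ x ∈ ball (0 : EuclideanSpace ℝ (Fin 3)) 1, 0 ≤ V t x)
    (htstar : 0 < tstar) (hτT : τ ≤ T) (h2R : 2 * R ≤ R') (hR'1 : R' < 1)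
    (hχc : Continuous χ) (hχ0 : ∀ x, 0 ≤ χ x) (hχball : tsupport χ ⊆ ball (0 : EuclideanSpace ℝ (Fin 3)) 1)
    (hχone : ∀ x ∈ closedBall (0 : EuclideanSpace ℝ (Fin 3)) R', χ x = 1)
    (hψc : Continuous ψ) (hψ0 : ∀ s, 0 ≤ ψ s) (hψz : ∀ s, s ≤ tstar / 2 → ψ s = 0)
    (hφz : ∀ s, s < tstar / 2 → ψ₁ s = 0) (hφ1 : ∀ s, tstar / 2 ≤ s → ψ₁ s = 1) :
    NUEnergyClass (frameΦ χ ψ V τ) (frameU ψ₁ b τ) k R := by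
  rw [nuEnergyClass_iff]
  intro H hH2 hH' hH0 hH'' hHsq _hHk Θ hΘ1 hΘc hΘsupp η hη1 hη0 t₁ t₂ _ht₁ ht₁₂ ht₂
  obtain ⟨L, hL⟩ := hVL
  have hVc : ContinuousOn (uncurry V) (Ioo 0 T ×ˢ ball (0 : EuclideanSpace ℝ (Fin 3)) 1) := hL.continuousOn
  have hΦm : Measurable (uncurry (frameΦ χ ψ V τ)) := measurable_frameΦ hχc hχball hψc hψz htstar hτT hVc
  have hΦnn : ∀ t x, 0 ≤ frameΦ χ ψ V τ t x := frameΦ_nonneg hχ0 hχball hψ0 hψz htstar hτT hV0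
  set c : ℝ := tstar / 2 - τ with hc
  -- the frame profile vanishes for `t ≤ c`, the frame drift for `t < c`
  have hΦ0c : ∀ t, t ≤ c → ∀ x, frameΦ χ ψ V τ t x = 0 := by
    intro t ht x
    by_cases ht0 : t < 0
    · rw [frameΦ_of_neg ht0, hψz _ (by linarith), zero_mul, mul_zero]
    · exact frameΦ_of_nonneg (not_lt.1 ht0) x
  have hU0c : ∀ t, t < c → ∀ x, frameU ψ₁ b τ t x = 0 := by
    intro t ht x
    by_cases h : t < 0 ∧ ‖x‖ < 1
    · rw [frameU_eq_of_norm_lt_one h.1 h.2, hφz _ (by linarith), zero_smul]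
    · exact frameU_eq_zero h
  -- transport on `[a, t₂]` for `c ≤ a ≤ t₂`
  have hstepA : ∀ a, c ≤ a → a ≤ t₂ → nuSlabIneq (frameΦ χ ψ V τ) (frameU ψ₁ b τ) H Θ η a t₂ := by
    intro a hca hat₂
    have ha : tstar / 2 ≤ a + τ := by linarith
    refine nuSlabIneq_frame_of_data hχone h2R hR'1.le hφ1 ha hat₂ ht₂ hΘsupp ?_
    exact hineq H hH2 hH' hH0 hH'' hHsq Θ hΘ1 hΘc (2 * R) (by linarith) hΘsupp (fun s => η (s - τ))
      (hη1.comp (contDiff_id.sub contDiff_const)) (fun s => hη0 _) (a + τ) (t₂ + τ) (by linarith)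
      (by linarith) (by linarith)
  -- extension downwards
  have hAC := integrableOn_frame_AC (χ := χ) (ψ := ψ) (V := V) (τ := τ) (u := t₁) (v := t₂)
    hH2 hH' hH0 hΘ1 hΘc hη1 hΦm hΦnn
  have hstepB : ∀ a, t₁ ≤ a → a ≤ t₂ → a ≤ c →
      nuSlabIneq (frameΦ χ ψ V τ) (frameU ψ₁ b τ) H Θ η a t₂ →
      nuSlabIneq (frameΦ χ ψ V τ) (frameU ψ₁ b τ) H Θ η t₁ t₂ := fun a h1 h2 h3 h =>
    nuSlabIneq_extend h1 h2 hH0 hη1 hη0 (fun t ht x => hΦ0c t (ht.trans h3) x)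
      (fun t ht x => hU0c t (ht.trans_le h3) x) hAC.1 hAC.2 h
  -- the three cases
  rcases le_or_gt t₂ c with h₂c | hc₂
  · exact hstepB t₂ ht₁₂ le_rfl h₂c (nuSlabIneq_self _ _ H Θ η t₂)
  · rcases le_or_gt c t₁ with hc₁ | h₁c
    · exact hstepA t₁ hc₁ ht₁₂
    · exact hstepB c h₁c.le hc₂.le le_rfl (hstepA c le_rfl hc₂.le)

end Frame

/-! ### The theorem consumed by the W assembly -/

/-- **Frames from weak data and the data-coordinate energy inequality** (bricks (c2) + (c); the antecedent of
ser-c's W assembly): for the weak Lipschitz data of the typed fact on `]0,T[ × B(0,1)` (`b` jointly measurable,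
`‖b‖ ≤ Λ`, `V` Lipschitz and nonnegative), an admissible frame `0 < k`, `0 < t⋆`, `τ ≤ T`, `0 < R`, `2R < 1`, a
time cut-off `ψ` (continuous, `0 ≤ ψ ≤ 1`, `= 0` on `]-∞,t⋆/2]`, `= 1` on `[t⋆,∞[`) and the slab inequality `hineq`
for the pair `(fun s x => ψ s * V s x, b)` on `]0,T[` (= `nu_energyIneq_of_weak hW1` at the cut-off data), there
are `Φ, U` with `NUStandingLip Φ U k R (nuDriftConst Λ)` and `Φ(t,x) = V(t+τ,x)` for `t⋆ ≤ t+τ`, `t < 0`,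
`x ∈ B(0,2R)`. Construction: `Φ = frameΦ χ ψ V τ`, `U = frameU 𝟙_{[t⋆/2,∞[} b τ`, `χ` a smooth bump equal to `1` on
`B̄(0,(2R+1)/2)` and supported in `B(0,1)`. -/
theorem exists_nuStandingLip_frame_of_energyIneq {Λ T τ tstar k R : ℝ}
    {V : ℝ → EuclideanSpace ℝ (Fin 3) → ℝ} {b : ℝ → EuclideanSpace ℝ (Fin 3) → EuclideanSpace ℝ (Fin 3)}
    {ψ : ℝ → ℝ} (hΛ : 0 ≤ Λ)
    (hbm : Measurable (uncurry b))
    (hbΛ : ∀ t ∈ Ioo 0 T, ∀ x ∈ ball (0 : EuclideanSpace ℝ (Fin 3)) 1, ‖b t x‖ ≤ Λ)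
    (hVL : ∃ L, LipschitzOnWith L (uncurry V) (Ioo 0 T ×ˢ ball (0 : EuclideanSpace ℝ (Fin 3)) 1))
    (hV0 : ∀ t ∈ Ioo 0 T, ∀ x ∈ ball (0 : EuclideanSpace ℝ (Fin 3)) 1, 0 ≤ V t x)
    (hk : 0 < k) (htstar : 0 < tstar) (hτT : τ ≤ T) (hR : 0 < R) (h2R : 2 * R < 1)
    (hψc : Continuous ψ) (hψ01 : ∀ s, 0 ≤ ψ s ∧ ψ s ≤ 1) (hψz : ∀ s, s ≤ tstar / 2 → ψ s = 0)
    (hψ1 : ∀ s, tstar ≤ s → ψ s = 1)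
    (hineq : ∀ (H : ℝ → ℝ), ContDiff ℝ 2 H → (∀ v, deriv H v ≤ 0) → (∀ v, 0 ≤ H v) →
      (∀ v, 0 ≤ deriv (deriv H) v) → (∀ v, deriv H v ^ 2 ≤ 2 * H v * deriv (deriv H) v) →
      ∀ (Θ : EuclideanSpace ℝ (Fin 3) → ℝ), ContDiff ℝ 1 Θ → HasCompactSupport Θ →
      ∀ (ρ₀ : ℝ), ρ₀ < 1 → tsupport Θ ⊆ ball (0 : EuclideanSpace ℝ (Fin 3)) ρ₀ →
      ∀ (η : ℝ → ℝ), ContDiff ℝ 1 η → (∀ s, 0 ≤ η s) →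
      ∀ (t₁ t₂ : ℝ), 0 < t₁ → t₁ ≤ t₂ → t₂ < T →
        nuSlabIneq (fun s x => ψ s * V s x) b H Θ η t₁ t₂) :
    ∃ (Φ : ℝ → EuclideanSpace ℝ (Fin 3) → ℝ) (U : ℝ → EuclideanSpace ℝ (Fin 3) → EuclideanSpace ℝ (Fin 3)),
      NUStandingLip Φ U k R (nuDriftConst Λ) ∧
      ∀ t x, tstar ≤ t + τ → t < 0 → x ∈ ball (0 : EuclideanSpace ℝ (Fin 3)) (2 * R) → Φ t x = V (t + τ) x := by
  -- the space cut-off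
  set R' : ℝ := (2 * R + 1) / 2 with hR'
  have h2RR' : 2 * R ≤ R' := by rw [hR']; linarith
  have hR'1 : R' < 1 := by rw [hR']; linarith
  have hR'pos : 0 < R' := by linarith
  let χb : ContDiffBump (0 : EuclideanSpace ℝ (Fin 3)) := ⟨R', (R' + 1) / 2, hR'pos, by linarith⟩
  set χ : EuclideanSpace ℝ (Fin 3) → ℝ := fun x => χb x with hχ
  have hχone : ∀ x ∈ closedBall (0 : EuclideanSpace ℝ (Fin 3)) R', χ x = 1 := fun x hx =>
    χb.one_of_mem_closedBall hx
  have hχball : tsupport χ ⊆ ball (0 : EuclideanSpace ℝ (Fin 3)) 1 := by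
    rw [show tsupport χ = closedBall (0 : EuclideanSpace ℝ (Fin 3)) ((R' + 1) / 2) from χb.tsupport_eq]
    exact closedBall_subset_ball (by linarith)
  have hχ01 : ∀ x, 0 ≤ χ x ∧ χ x ≤ 1 := fun x => ⟨χb.nonneg, χb.le_one⟩
  have hχ1 : ContDiff ℝ 1 χ := χb.contDiff
  have hχc : HasCompactSupport χ := χb.hasCompactSupport
  -- the time cut-off of the drift
  set ψ₁ : ℝ → ℝ := (Ici (tstar / 2)).indicator fun _ => 1 with hψ₁
  have hψ₁m : Measurable ψ₁ := (measurable_const.indicator measurableSet_Ici)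
  have hφ01 : ∀ s, 0 ≤ ψ₁ s ∧ ψ₁ s ≤ 1 := fun s => by
    by_cases hs : s ∈ Ici (tstar / 2)
    · simp only [hψ₁, indicator_of_mem hs]; norm_num
    · simp only [hψ₁, indicator_of_notMem hs]; norm_num
  have hφz : ∀ s, s < tstar / 2 → ψ₁ s = 0 := fun s hs => by
    simp only [hψ₁, indicator_of_notMem (show s ∉ Ici (tstar / 2) from fun h => (not_le.2 hs) h)]
  have hφz4 : ∀ s, s ≤ tstar / 4 → ψ₁ s = 0 := fun s hs => hφz s (by linarith)
  have hφ1 : ∀ s, tstar / 2 ≤ s → ψ₁ s = 1 := fun s hs => by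
    simp only [hψ₁, indicator_of_mem (show s ∈ Ici (tstar / 2) from hs)]
  -- the energy class (c2) and the packaging (c)
  have hEC : NUEnergyClass (frameΦ χ ψ V τ) (frameU ψ₁ b τ) k R :=
    nuEnergyClass_frame hineq hVL hV0 htstar hτT h2RR' hR'1 hχ1.continuous (fun x => (hχ01 x).1) hχball
      hχone hψc (fun s => (hψ01 s).1) hψz hφz hφ1
  exact exists_nuStandingLip_frame hΛ hbm hbΛ hVL hV0 hk htstar hτT hR h2RR' hR'1 hχ1 hχc hχ01 hχball hχone
    hψc hψ01 hψz hψ1 hψ₁m hφ01 hφz4 hEC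

end Summit.NavierStokesRegularity.NavierStokesRegularity.Theorems.AveragedConeLiouville.NUPositivity

end
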